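/-
Copyright (c) 2026 the pub-hodgecm-mathlib formalisation cell (harness21).  Prover seat hodgecm-mathlib-K2E1-p08 (g4), Track B ∕ K2-LIT, h413 =
`stmt-HodgeConjecture-24833`, line `K2_E1_TraceFormulaBeta`, campaign «EIS-RANK-ONE» toward (H4-b); DEAL «EIS-U3-GODEMENT» of the dealer K2E1-plan (g3) 2026-09-04T04:19:39Z,
file (D) as amended by RULING «R-EIS-1» (04:25:41Z): the DEFINITIONS `eisensteinSeriesU` (Borel Eisenstein series of a unitary group `U(J)`) and `flatSectionU` (flat sections of `U(J_N)`).
-/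
import Summits.HodgeConjecture.HodgeConjecture.Theorems.K2E1BruhatCosetsU          -- ★ p857160 (K2E1-p09 (g4)): the coset type `B(F)\G(F) = Quotient (orbitRel ↥borelU ↥U)`, `Option N(F) ≃ B\G`
import Literature.NumberTheory.Automorphic.UnitaryGroupBorelHeightContinuous       -- ★ `borelHeight`, `borelHeight_rational_borel_mul`, `continuous_borelHeight`, `vecHeight_lastRow_pos`
import Literature.NumberTheory.Automorphic.UnitaryGroupCharpolyBorelClasses         -- ★ `toAdelic_mem_borelAdelic_iff` (rational Borel ↔ adelic Borel)
import Mathlib.Analysis.SpecialFunctions.Pow.Real                                   -- Mathlib `Complex.norm_cpow_eq_rpow_re_of_pos`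
import HarnessLib

/-!
# K2·E1 — `K2E1BorelEisensteinUDefs`: THE BOREL EISENSTEIN SERIES `E(f)(g) = Σ_{γ ∈ B(F)∖G(F)} f(γ g)` AND THE FLAT SECTIONS `f_z = φ · H^z` (definitions leaf)

Track B ∕ K2-LIT, crux h413 = `stmt-HodgeConjecture-24833`, route of record `HCCMUnconditional`; cell `hodgecm-mathlib`, squad K2, ENGINE E1, campaign «EIS-RANK-ONE» (the
Eisenstein side of the single remaining named input (H4-b) «exponent finiteness» of 5Res ∕ 12R3).  Prover seat `hodgecm-mathlib-K2E1-p08` (g4); DEAL «EIS-U3-GODEMENT» of the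
dealer K2E1-plan (g3) 2026-09-04T04:19:39Z, file (D), as amended by RULING «R-EIS-1» (04:25:41Z: index type = ★ p857160's rational `borelU`-cosets; section as argument, exponent
raw; N-generic).  DEFINITIONS LEAF (R6: TWO `def`s with bodies + unfolding ∕ structure theorems; no `instance`, no notation, no named-fact hypothesis, no `sorry`); lane
`--kind definition --supports stmt-HodgeConjecture-24833 --as helper` (count-neutral).  Closes no socket.

THE DEFINITIONS.
* **`eisensteinSeriesU f g := ∑' q : B(F)∖G(F), f(γ̃_q · g)`** — for the tree's GENERIC unitary datum `adelicGroupData F E c N J` of a form `J ∈ M_N(E)` (`G(F) = U(J)(F) =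
  unitaryGroupOfForm c J ≤ GL_N(E)`, `B(F) = borelU c J` its upper-triangular subgroup, ★ `UnitaryGroupBorelInduction`), `f : U(J)(𝔸_F) → ℂ`, `g ∈ U(J)(𝔸_F)`: a `tsum` over ★
  p857160's coset type `Quotient (MulAction.orbitRel ↥(borelU c J) ↥(unitaryGroupOfForm c J))` (orbits of LEFT multiplication by `B(F)`, i.e. the cosets `B(F)γ`), `γ̃_q =
  toAdelic (Quotient.out q)`; junk `0` off the domain of summability (Mathlib `tsum`).  NO exponent and NO character inside: the section is the argument `f`.  The FORM IS A
  PARAMETER so that both currencies of the campaign instantiate it literally: Mok's `quasiSplit F E c N` is the `abbrev` `adelicGroupData F E c N ((StdForm.antidiagonal N).over E)`,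
  and the CM datum `cmDatum L N H` of ANY matrix `H` (e.g. the K2Liu junction's literal `Φ₂`, ★ p857306) is `adelicGroupData L⁺ L c N H` by ★ `adelicGroupData_eq_cmDatum` (`rfl`).
* **`flatSectionU φ z := fun g ↦ φ g · H(g)^z`** on Mok's `U(J_N)(𝔸_F) = (quasiSplit F E c N).Adelic`, `H = ` ★ `borelHeight` (`H(t g) = ‖d₀(t)‖_{𝔸_E} · H(g)`), RAW complex exponent
  `z`.  DICTIONARY: `N = 3` (`U(Φ₃) = U(2,1)`): `δ_B = H²` (★ p857223 `borelHeight_torus_mul_sq_modularCharacter`), `e^{⟨ρ, H_B⟩} = H`, so the printed flat section `φ_s` of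
  [MoeglinWaldspurger1995, II.1.5] ∕ [Rogawski1990, §2.2] is `flatSectionU φ (s + 1)` and Godement's half-plane of absolute convergence `Re s > ρ = 1` reads **`2 < z.re`**;
  `N = 2` (`U(Φ₂) = U(1,1)`): `δ_B = H`, `φ_s = flatSectionU φ (s + ½)`, convergence `Re s > ½` reads **`1 < z.re`** (K2Liu's Siegel section `(√‖b₀₀‖)^{2s+1}`, ★ #9).
  The Borel Eisenstein series of the campaign is `eisensteinSeriesU (flatSectionU φ z)` (`eisensteinSeriesU_flatSectionU`).

WHAT.
* §0 PURE GROUP THEORY on `B∖G = Quotient (orbitRel ↥B G)` (any group): `apply_out_mk` (a left-`B`-invariant function does not see the choice of representative), `rightMulQuot`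
  (right multiplication by `γ₀` permutes `B∖G`), `tsum_quotient_eq_apply_one_add_tsum` (along ★ p857160's `Option ↥N ≃ B∖G`: `Σ'_q T q = T[1] + Σ'_n T[w n]` under `Summable`).
* §1 `eisensteinSeriesU` + `_def`, `_zero`, `_smul`, `_add`; **`eisensteinSeriesU_term_eq`** (INDEPENDENCE OF REPRESENTATIVES for left-`B(F)`-invariant `f`), `eisensteinSeriesU_eq_tsum`
  (any section of the cosets), **`eisensteinSeriesU_rational_mul`** (`E(f)(γ₀ g) = E(f)(g)` for `γ₀ ∈ G(F)` — reindexing by `rightMulQuot`, NO convergence needed),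
  **`eisensteinSeriesU_eq_apply_add_tsum_unipotent_two ∕ _three`** (`E(f)(g) = f(g) + Σ'_{n ∈ N(F)} f(w₀ n g)` on `U(J₂)`, `U(J₃)` under `Summable`, ★ p857160).
* §2 `flatSectionU` + `_apply`, `toAdelic_mem_borelAdelic_of_mem_borelU` (★ `toAdelic_mem_borelAdelic_iff`), `borelHeight_toAdelic_mul_of_mem_borelU`, **`flatSectionU_toAdelic_mul`**
  (flat sections of left-`B(F)`-invariant `φ` are left-`B(F)`-invariant, ★ `borelHeight_rational_borel_mul`), `norm_flatSectionU` (`‖f_z(g)‖ = ‖φ g‖ · H(g)^{Re z}`),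
  `continuous_flatSectionU`, `eisensteinSeriesU_flatSectionU` (the series of the campaign, unfolded).
HONEST LABEL: HC_CM is proved only modulo the 7 printed citations (2 remaining named inputs: hLiu418 = `stmt-HodgeConjecture-24832`, h413 = `stmt-HodgeConjecture-24833`) until rung 0
closes; definitions leaf, proves no printed statement, closes no socket.
References: [MoeglinWaldspurger1995] C. Mœglin, J.-L. Waldspurger, *Spectral Decomposition and Eisenstein Series* (1995), II.1.5, II.1.7 · [Rogawski1990] J. D. Rogawski,
*Automorphic Representations of Unitary Groups in Three Variables* (1990), §1.10, §2.2 · [Garrett2018] P. Garrett, *Modern Analysis of Automorphic Forms by Example* (2018), §2.2,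
§2.10, §3.10 · [Godement1964] R. Godement, Sém. Bourbaki 257, §8.
-/

set_option autoImplicit false
-- the mandated namespace repeats the single-problem summit's segment (`HodgeConjecture.HodgeConjecture`)
set_option linter.dupNamespace false

noncomputable section

open NumberField IsDedekindDomain Topology MulAction
open scoped NNReal MatrixGroups
open Literature.NumberTheory.Automorphic Literature.NumberTheory.Automorphic.UnitaryGroup

namespace Summit.HodgeConjecture.HodgeConjecture.Cruxes.H413.K2E1BorelEisensteinU

/-! ## §0 Pure group theory on `B∖G` -/

section Abstract

variable {G : Type*} [Group G] {B : Subgroup G}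

/-- A left-`B`-invariant function does not see the choice of representative: `T([γ].out) = T(γ)` (★ p857160 `exists_out_mk_eq`: `[γ].out = b γ`). [folklore] -/
theorem apply_out_mk {M : Type*} {T : G → M} (hT : ∀ b ∈ B, ∀ γ : G, T (b * γ) = T γ) (γ : G) :
    T ((Quotient.mk (orbitRel B G) γ).out) = T γ := by
  obtain ⟨b, hb, h⟩ := K2E1BruhatCosetsU.exists_out_mk_eq (B := B) γ
  rw [h, hT b hb]

variable (B) in
/-- Right multiplication by `γ₀` permutes `B∖G`: the bijection `Bγ ↦ Bγγ₀` (inverse: `γ₀⁻¹`). [folklore] -/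
def rightMulQuot (γ₀ : G) : Quotient (orbitRel B G) ≃ Quotient (orbitRel B G) where
  toFun := Quotient.map' (fun γ => γ * γ₀) fun a b h => by
    rw [orbitRel_apply, mem_orbit_iff] at h ⊢
    obtain ⟨x, hx⟩ := h
    exact ⟨x, by change (x : G) * b = a at hx; change (x : G) * (b * γ₀) = a * γ₀; rw [← hx, mul_assoc]⟩
  invFun := Quotient.map' (fun γ => γ * γ₀⁻¹) fun a b h => by
    rw [orbitRel_apply, mem_orbit_iff] at h ⊢
    obtain ⟨x, hx⟩ := h
    exact ⟨x, by change (x : G) * b = a at hx; change (x : G) * (b * γ₀⁻¹) = a * γ₀⁻¹; rw [← hx, mul_assoc]⟩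
  left_inv q := Quotient.inductionOn' q fun γ => by
    change Quotient.mk'' (γ * γ₀ * γ₀⁻¹) = Quotient.mk'' γ
    rw [mul_inv_cancel_right]
  right_inv q := Quotient.inductionOn' q fun γ => by
    change Quotient.mk'' (γ * γ₀⁻¹ * γ₀) = Quotient.mk'' γ
    rw [inv_mul_cancel_right]

/-- `rightMulQuot B γ₀ [γ] = [γ γ₀]`. [folklore] -/
theorem rightMulQuot_mk (γ₀ γ : G) : rightMulQuot B γ₀ (Quotient.mk (orbitRel B G) γ) = Quotient.mk (orbitRel B G) (γ * γ₀) := rfl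

/-- **`Σ'_{q ∈ B∖G} T(q) = T([1]) + Σ'_{n ∈ N} T([w n])`** along a bijection `e : Option ↥N ≃ B∖G` with `e none = [1]`, `e (some n) = [w n]` (★ p857160's coset form of a rank-one Bruhat
decomposition), for a summable `T` with values in a complete normed group. [cite: MoeglinWaldspurger1995, II.1.7] -/
theorem tsum_quotient_eq_apply_one_add_tsum {M : Type*} [NormedAddCommGroup M] [CompleteSpace M] {N' : Subgroup G} {w : G}
    (e : Option ↥N' ≃ Quotient (orbitRel B G)) (he₁ : e none = Quotient.mk (orbitRel B G) 1)
    (hew : ∀ n : N', e (some n) = Quotient.mk (orbitRel B G) (w * (n : G))) {T : Quotient (orbitRel B G) → M} (hT : Summable T) :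
    ∑' q, T q = T (Quotient.mk (orbitRel B G) 1) + ∑' n : N', T (Quotient.mk (orbitRel B G) (w * (n : G))) := by
  have hTe : Summable (fun x : ↥N' ⊕ PUnit.{1} => T (e ((Equiv.optionEquivSumPUnit.{0} ↥N').symm x))) :=
    (Equiv.optionEquivSumPUnit.{0} ↥N').symm.summable_iff.2 (e.summable_iff.2 hT)
  rw [← e.tsum_eq, ← (Equiv.optionEquivSumPUnit.{0} ↥N').symm.tsum_eq]
  change ∑' x : ↥N' ⊕ PUnit.{1}, T (e ((Equiv.optionEquivSumPUnit.{0} ↥N').symm x)) = _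
  rw [Summable.tsum_sum (hTe.comp_injective Sum.inl_injective) (hTe.comp_injective Sum.inr_injective)]
  simp only [Equiv.optionEquivSumPUnit_symm_inl, Equiv.optionEquivSumPUnit_symm_inr, hew, he₁, tsum_fintype, Finset.univ_unique,
    Finset.sum_singleton]
  exact add_comm _ _

end Abstract

/-! ## §1 The Borel Eisenstein series of `U(J)` -/

section Generic

variable {F E : Type} [Field F] [NumberField F] [Field E] [NumberField E] [Algebra F E] {c : E ≃ₐ[F] E} {N : ℕ} {J : Matrix (Fin N) (Fin N) E}

/-- **The Borel Eisenstein series of the unitary group `U(J)`**: `E(f)(g) = ∑' q : B(F)∖G(F), f(γ̃_q · g)`, `γ̃_q = toAdelic (Quotient.out q)` the adelic image of the chosen representative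
of the coset `q` of `B(F) = borelU c J` in `G(F) = unitaryGroupOfForm c J`; no exponent, no character — the section is `f` (for the campaign, `f = flatSectionU φ z`); junk `0` off the
domain of summability.  Typed for the generic datum `adelicGroupData F E c N J` (Mok's `quasiSplit F E c N` and every `cmDatum L N H` are instances by `rfl`).
[cite: MoeglinWaldspurger1995, II.1.5] [cite: Rogawski1990, §2.2] [cite: Garrett2018, §3.10] -/
def eisensteinSeriesU (f : (adelicGroupData F E c N J).Adelic → ℂ) (g : (adelicGroupData F E c N J).Adelic) : ℂ :=
  ∑' q : Quotient (orbitRel ↥(borelU (c : E →+* E) J) ↥(unitaryGroupOfForm (c : E →+* E) J)),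
    f ((adelicGroupData F E c N J).toAdelic (Quotient.out q : ↥(unitaryGroupOfForm (c : E →+* E) J)) * g)

/-- Unfolding `eisensteinSeriesU`. [cite: MoeglinWaldspurger1995, II.1.5] -/
theorem eisensteinSeriesU_def (f : (adelicGroupData F E c N J).Adelic → ℂ) (g : (adelicGroupData F E c N J).Adelic) :
    eisensteinSeriesU f g = ∑' q : Quotient (orbitRel ↥(borelU (c : E →+* E) J) ↥(unitaryGroupOfForm (c : E →+* E) J)),
      f ((adelicGroupData F E c N J).toAdelic (Quotient.out q : ↥(unitaryGroupOfForm (c : E →+* E) J)) * g) := rfl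

/-- `E(0) = 0`. [folklore] -/
@[simp] theorem eisensteinSeriesU_zero (g : (adelicGroupData F E c N J).Adelic) : eisensteinSeriesU (0 : (adelicGroupData F E c N J).Adelic → ℂ) g = 0 := by
  simp [eisensteinSeriesU]

/-- `E(a • f) = a · E(f)` (`tsum` is homogeneous, with or without convergence). [folklore] -/
theorem eisensteinSeriesU_smul (a : ℂ) (f : (adelicGroupData F E c N J).Adelic → ℂ) (g : (adelicGroupData F E c N J).Adelic) :
    eisensteinSeriesU (a • f) g = a * eisensteinSeriesU f g := by
  simp only [eisensteinSeriesU, Pi.smul_apply, smul_eq_mul]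
  exact tsum_mul_left

/-- `E(f₁ + f₂)(g) = E(f₁)(g) + E(f₂)(g)` when both series converge at `g`. [folklore] -/
theorem eisensteinSeriesU_add {f₁ f₂ : (adelicGroupData F E c N J).Adelic → ℂ} {g : (adelicGroupData F E c N J).Adelic}
    (h₁ : Summable fun q : Quotient (orbitRel ↥(borelU (c : E →+* E) J) ↥(unitaryGroupOfForm (c : E →+* E) J)) => f₁ ((adelicGroupData F E c N J).toAdelic (Quotient.out q : ↥(unitaryGroupOfForm (c : E →+* E) J)) * g))
    (h₂ : Summable fun q : Quotient (orbitRel ↥(borelU (c : E →+* E) J) ↥(unitaryGroupOfForm (c : E →+* E) J)) => f₂ ((adelicGroupData F E c N J).toAdelic (Quotient.out q : ↥(unitaryGroupOfForm (c : E →+* E) J)) * g)) :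
    eisensteinSeriesU (f₁ + f₂) g = eisensteinSeriesU f₁ g + eisensteinSeriesU f₂ g := by
  simp only [eisensteinSeriesU, Pi.add_apply]
  exact h₁.tsum_add h₂

/-- **INDEPENDENCE OF THE REPRESENTATIVES**: for left-`B(F)`-invariant `f`, the term of `E(f)(g)` at the coset of `γ ∈ G(F)` is `f(γ g)`. [cite: Garrett2018, §2.10] [cite: MoeglinWaldspurger1995, II.1.5] -/
theorem eisensteinSeriesU_term_eq {f : (adelicGroupData F E c N J).Adelic → ℂ}
    (hf : ∀ b ∈ borelU (c : E →+* E) J, ∀ x : (adelicGroupData F E c N J).Adelic, f ((adelicGroupData F E c N J).toAdelic b * x) = f x)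
    (γ : ↥(unitaryGroupOfForm (c : E →+* E) J)) (g : (adelicGroupData F E c N J).Adelic) :
    f ((adelicGroupData F E c N J).toAdelic (Quotient.mk (orbitRel ↥(borelU (c : E →+* E) J) ↥(unitaryGroupOfForm (c : E →+* E) J)) γ).out * g) =
      f ((adelicGroupData F E c N J).toAdelic γ * g) :=
  apply_out_mk (B := borelU (c : E →+* E) J) (T := fun δ : ↥(unitaryGroupOfForm (c : E →+* E) J) => f ((adelicGroupData F E c N J).toAdelic δ * g))
    (fun b hb δ => by
      have hm : (adelicGroupData F E c N J).toAdelic (b * δ) = (adelicGroupData F E c N J).toAdelic b * (adelicGroupData F E c N J).toAdelic δ :=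
        map_mul _ _ _
      change f ((adelicGroupData F E c N J).toAdelic (b * δ) * g) = f ((adelicGroupData F E c N J).toAdelic δ * g)
      rw [hm, mul_assoc, hf b hb]) γ

/-- **`E(f)(g)` through ANY section of the cosets**: if `γ_q ∈ q` for every `q` (`Quotient.mk γ_q = q`), then `E(f)(g) = ∑' q, f(γ_q g)`. [cite: Garrett2018, §2.10] -/
theorem eisensteinSeriesU_eq_tsum {f : (adelicGroupData F E c N J).Adelic → ℂ}
    (hf : ∀ b ∈ borelU (c : E →+* E) J, ∀ x : (adelicGroupData F E c N J).Adelic, f ((adelicGroupData F E c N J).toAdelic b * x) = f x)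
    (g : (adelicGroupData F E c N J).Adelic)
    (sec : Quotient (orbitRel ↥(borelU (c : E →+* E) J) ↥(unitaryGroupOfForm (c : E →+* E) J)) → ↥(unitaryGroupOfForm (c : E →+* E) J))
    (hsec : ∀ q, Quotient.mk (orbitRel ↥(borelU (c : E →+* E) J) ↥(unitaryGroupOfForm (c : E →+* E) J)) (sec q) = q) :
    eisensteinSeriesU f g = ∑' q : Quotient (orbitRel ↥(borelU (c : E →+* E) J) ↥(unitaryGroupOfForm (c : E →+* E) J)),
      f ((adelicGroupData F E c N J).toAdelic (sec q) * g) := by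
  refine tsum_congr fun q => ?_
  have h := eisensteinSeriesU_term_eq hf (sec q) g
  rwa [hsec q] at h

/-- **AUTOMORPHY**: `E(f)(γ₀ g) = E(f)(g)` for every `γ₀ ∈ G(F)` and every left-`B(F)`-invariant `f` — right multiplication by `γ₀` permutes `B(F)∖G(F)` (`rightMulQuot`, Mathlib
`Equiv.tsum_eq`) and the terms do not depend on the representatives; NO convergence is needed. [cite: MoeglinWaldspurger1995, II.1.5] [cite: Garrett2018, §3.10] -/
theorem eisensteinSeriesU_rational_mul {f : (adelicGroupData F E c N J).Adelic → ℂ}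
    (hf : ∀ b ∈ borelU (c : E →+* E) J, ∀ x : (adelicGroupData F E c N J).Adelic, f ((adelicGroupData F E c N J).toAdelic b * x) = f x)
    (γ₀ : ↥(unitaryGroupOfForm (c : E →+* E) J)) (g : (adelicGroupData F E c N J).Adelic) :
    eisensteinSeriesU f ((adelicGroupData F E c N J).toAdelic γ₀ * g) = eisensteinSeriesU f g := by
  have hsec : ∀ q : Quotient (orbitRel ↥(borelU (c : E →+* E) J) ↥(unitaryGroupOfForm (c : E →+* E) J)),
      Quotient.mk (orbitRel ↥(borelU (c : E →+* E) J) ↥(unitaryGroupOfForm (c : E →+* E) J)) (q.out * γ₀) = rightMulQuot (borelU (c : E →+* E) J) γ₀ q := fun q => by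
    conv_rhs => rw [← Quotient.out_eq q]
    rfl
  rw [eisensteinSeriesU_def, eisensteinSeriesU_def,
    ← (rightMulQuot (borelU (c : E →+* E) J) γ₀).tsum_eq (fun q' : Quotient (orbitRel ↥(borelU (c : E →+* E) J) ↥(unitaryGroupOfForm (c : E →+* E) J)) =>
      f ((adelicGroupData F E c N J).toAdelic (Quotient.out q' : ↥(unitaryGroupOfForm (c : E →+* E) J)) * g))]
  refine tsum_congr fun q => ?_
  have h := eisensteinSeriesU_term_eq hf (q.out * γ₀) g
  rw [hsec q] at h
  have hm : (adelicGroupData F E c N J).toAdelic (q.out * γ₀) = (adelicGroupData F E c N J).toAdelic q.out * (adelicGroupData F E c N J).toAdelic γ₀ :=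
    map_mul _ _ _
  rw [h, hm, mul_assoc]

/-- **`E(f)(g) = f(g) + Σ'_{n ∈ N(F)} f(w₀ n g)` on `U(J₂)`** (`J₂ = Φ₂`, `w₀ = Φ₂`, `N = unipotentU`): ★ p857160's coset form `B(F)∖G(F) = {[1]} ⊔ {[w₀ n]}` of the rank-one Bruhat
decomposition, for left-`B(F)`-invariant `f` whose series converges at `g`. [cite: MoeglinWaldspurger1995, II.1.7] [cite: Rogawski1990, §1.10] -/
theorem eisensteinSeriesU_eq_apply_add_tsum_unipotent_two {J : Matrix (Fin 2) (Fin 2) E} (hJ : J = (StdForm.antidiagonal 2).over E) {f : (adelicGroupData F E c 2 J).Adelic → ℂ}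
    (hf : ∀ b ∈ borelU (c : E →+* E) J, ∀ x : (adelicGroupData F E c 2 J).Adelic, f ((adelicGroupData F E c 2 J).toAdelic b * x) = f x)
    {g : (adelicGroupData F E c 2 J).Adelic}
    (hs : Summable fun q : Quotient (orbitRel ↥(borelU (c : E →+* E) J) ↥(unitaryGroupOfForm (c : E →+* E) J)) => f ((adelicGroupData F E c 2 J).toAdelic (Quotient.out q : ↥(unitaryGroupOfForm (c : E →+* E) J)) * g)) :
    eisensteinSeriesU f g = f g + ∑' n : ↥(unipotentU (c : E →+* E) J),
      f ((adelicGroupData F E c 2 J).toAdelic (weylLongU (c : E →+* E) hJ * (n : ↥(unitaryGroupOfForm (c : E →+* E) J))) * g) := by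
  obtain ⟨e, he₁, hew⟩ := K2E1BruhatCosetsU.exists_equiv_option_borelQuotient_two (c : E →+* E) hJ
  have h1 : (adelicGroupData F E c 2 J).toAdelic (1 : ↥(unitaryGroupOfForm (c : E →+* E) J)) = 1 := map_one _
  rw [eisensteinSeriesU_def, tsum_quotient_eq_apply_one_add_tsum e he₁ hew hs, eisensteinSeriesU_term_eq hf, h1, one_mul]
  exact congrArg _ (tsum_congr fun n => eisensteinSeriesU_term_eq hf _ g)

/-- **`E(f)(g) = f(g) + Σ'_{n ∈ N(F)} f(w₀ n g)` on `U(J₃) = U(2,1)`** (`w₀ = Φ₃`, `N` the Heisenberg group `unipotentU`): ★ p857160's coset form of the Bruhat decomposition, for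
left-`B(F)`-invariant `f` whose series converges at `g`. [cite: MoeglinWaldspurger1995, II.1.7] [cite: Rogawski1990, §1.10] -/
theorem eisensteinSeriesU_eq_apply_add_tsum_unipotent_three {J : Matrix (Fin 3) (Fin 3) E} (hJ : J = (StdForm.antidiagonal 3).over E) {f : (adelicGroupData F E c 3 J).Adelic → ℂ}
    (hf : ∀ b ∈ borelU (c : E →+* E) J, ∀ x : (adelicGroupData F E c 3 J).Adelic, f ((adelicGroupData F E c 3 J).toAdelic b * x) = f x)
    {g : (adelicGroupData F E c 3 J).Adelic}
    (hs : Summable fun q : Quotient (orbitRel ↥(borelU (c : E →+* E) J) ↥(unitaryGroupOfForm (c : E →+* E) J)) => f ((adelicGroupData F E c 3 J).toAdelic (Quotient.out q : ↥(unitaryGroupOfForm (c : E →+* E) J)) * g)) :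
    eisensteinSeriesU f g = f g + ∑' n : ↥(unipotentU (c : E →+* E) J),
      f ((adelicGroupData F E c 3 J).toAdelic (weylLongU (c : E →+* E) hJ * (n : ↥(unitaryGroupOfForm (c : E →+* E) J))) * g) := by
  obtain ⟨e, he₁, hew⟩ := K2E1BruhatCosetsU.exists_equiv_option_borelQuotient_three (c : E →+* E) hJ
  have h1 : (adelicGroupData F E c 3 J).toAdelic (1 : ↥(unitaryGroupOfForm (c : E →+* E) J)) = 1 := map_one _
  rw [eisensteinSeriesU_def, tsum_quotient_eq_apply_one_add_tsum e he₁ hew hs, eisensteinSeriesU_term_eq hf, h1, one_mul]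
  exact congrArg _ (tsum_congr fun n => eisensteinSeriesU_term_eq hf _ g)

end Generic

/-! ## §2 The flat sections `f_z = φ · H^z` of `U(J_N)` -/

section Mok

variable {F E : Type} [Field F] [NumberField F] [Field E] [NumberField E] [Algebra F E] {c : E ≃ₐ[F] E} {N : ℕ} [NeZero N]

/-- **The flat section `f_z(g) = φ(g) · H(g)^z`** of `U(J_N)`: `H = borelHeight` (★), RAW complex exponent `z` (`N = 3`: the printed `φ_s = φ · e^{⟨s+ρ,H_B⟩}` is `flatSectionU φ (s+1)`,
Godement's half-plane is `2 < z.re`; `N = 2`: `flatSectionU φ (s+½)`, `1 < z.re`). [cite: MoeglinWaldspurger1995, II.1.5] [cite: Rogawski1990, §2.2] -/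
def flatSectionU (φ : (quasiSplit F E c N).Adelic → ℂ) (z : ℂ) : (quasiSplit F E c N).Adelic → ℂ :=
  fun g => φ g * ((borelHeight g : ℝ) : ℂ) ^ z

/-- Unfolding `flatSectionU`. [cite: MoeglinWaldspurger1995, II.1.5] -/
@[simp] theorem flatSectionU_apply (φ : (quasiSplit F E c N).Adelic → ℂ) (z : ℂ) (g : (quasiSplit F E c N).Adelic) :
    flatSectionU φ z g = φ g * ((borelHeight g : ℝ) : ℂ) ^ z := rfl

omit [NeZero N] in
/-- **Rational Borel elements are adelic Borel elements**: `b ∈ B(F) = borelU c J_N ⟹ toAdelic b ∈ B(𝔸_F) = borelAdelic` (★ `toAdelic_mem_borelAdelic_iff`, ★ `mem_borelU_iff`).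
[cite: Rogawski1990, §1.10] -/
theorem toAdelic_mem_borelAdelic_of_mem_borelU {b : ↥(unitaryGroupOfForm (c : E →+* E) ((StdForm.antidiagonal N).over E))}
    (hb : b ∈ borelU (c : E →+* E) ((StdForm.antidiagonal N).over E)) : (quasiSplit F E c N).toAdelic b ∈ borelAdelic F E c N :=
  (toAdelic_mem_borelAdelic_iff (F := F) (c := c) b).2 ((mem_borelU_iff b).1 hb)

/-- **`H(b x) = H(x)` for `b ∈ B(F)`** (★ `borelHeight_rational_borel_mul`). [cite: Garrett2018, §2.2] -/
theorem borelHeight_toAdelic_mul_of_mem_borelU {b : ↥(unitaryGroupOfForm (c : E →+* E) ((StdForm.antidiagonal N).over E))}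
    (hb : b ∈ borelU (c : E →+* E) ((StdForm.antidiagonal N).over E)) (x : (quasiSplit F E c N).Adelic) :
    borelHeight ((quasiSplit F E c N).toAdelic b * x) = borelHeight x :=
  borelHeight_rational_borel_mul b (toAdelic_mem_borelAdelic_of_mem_borelU hb) x

/-- **Flat sections of left-`B(F)`-invariant `φ` are left-`B(F)`-invariant**: `f_z(b x) = f_z(x)` for `b ∈ B(F)` — the shape `eisensteinSeriesU_term_eq` ∕ `_rational_mul` ∕
`_eq_apply_add_tsum_unipotent_*` consume. [cite: MoeglinWaldspurger1995, II.1.5] -/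
theorem flatSectionU_toAdelic_mul {φ : (quasiSplit F E c N).Adelic → ℂ}
    (hφ : ∀ b ∈ borelU (c : E →+* E) ((StdForm.antidiagonal N).over E), ∀ x : (quasiSplit F E c N).Adelic, φ ((quasiSplit F E c N).toAdelic b * x) = φ x) (z : ℂ) :
    ∀ b ∈ borelU (c : E →+* E) ((StdForm.antidiagonal N).over E), ∀ x : (quasiSplit F E c N).Adelic,
      flatSectionU φ z ((quasiSplit F E c N).toAdelic b * x) = flatSectionU φ z x := fun b hb x => by
  rw [flatSectionU_apply, flatSectionU_apply, hφ b hb x, borelHeight_toAdelic_mul_of_mem_borelU hb x]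

/-- **`‖f_z(g)‖ = ‖φ(g)‖ · H(g)^{Re z}`** (`H(g) > 0`, Mathlib `Complex.norm_cpow_eq_rpow_re_of_pos`) — only `Re z` governs absolute convergence. [cite: MoeglinWaldspurger1995, II.1.5] -/
theorem norm_flatSectionU (φ : (quasiSplit F E c N).Adelic → ℂ) (z : ℂ) (g : (quasiSplit F E c N).Adelic) :
    ‖flatSectionU φ z g‖ = ‖φ g‖ * (borelHeight g : ℝ) ^ z.re := by
  rw [flatSectionU_apply, norm_mul, Complex.norm_cpow_eq_rpow_re_of_pos]
  rw [borelHeight_def]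
  exact_mod_cast inv_pos.2 (vecHeight_lastRow_pos g)

/-- **Flat sections of continuous `φ` are continuous** (★ `continuous_borelHeight`; the complex power of a POSITIVE real base is continuous in the base). [cite: MoeglinWaldspurger1995, II.1.5] -/
theorem continuous_flatSectionU {φ : (quasiSplit F E c N).Adelic → ℂ} (hφ : Continuous φ) (z : ℂ) : Continuous (flatSectionU φ z) := by
  refine hφ.mul ?_
  have hH : Continuous fun g : (quasiSplit F E c N).Adelic => ((borelHeight g : ℝ) : ℂ) :=
    Complex.continuous_ofReal.comp (NNReal.continuous_coe.comp continuous_borelHeight)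
  refine hH.cpow continuous_const fun g => Or.inl ?_
  rw [Complex.ofReal_re, borelHeight_def]
  exact_mod_cast inv_pos.2 (vecHeight_lastRow_pos g)

omit [NeZero N] in
/-- A continuous `f` gives continuous Eisenstein summands `g ↦ f(γ̃ g)`. [cite: MoeglinWaldspurger1995, II.1.5] -/
theorem continuous_eisensteinTerm {f : (quasiSplit F E c N).Adelic → ℂ} (hf : Continuous f) (γ : (quasiSplit F E c N).Adelic) :
    Continuous fun g : (quasiSplit F E c N).Adelic => f (γ * g) :=
  hf.comp (continuous_const.mul continuous_id)

/-- **THE BOREL EISENSTEIN SERIES OF THE CAMPAIGN, UNFOLDED**: `E(f_z)(g) = ∑' q : B(F)∖G(F), φ(γ̃_q g) · H(γ̃_q g)^z` on `U(J_N)`. [cite: MoeglinWaldspurger1995, II.1.5] [cite: Rogawski1990, §2.2] -/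
theorem eisensteinSeriesU_flatSectionU (φ : (quasiSplit F E c N).Adelic → ℂ) (z : ℂ) (g : (quasiSplit F E c N).Adelic) :
    eisensteinSeriesU (flatSectionU φ z) g =
      ∑' q : Quotient (orbitRel ↥(borelU (c : E →+* E) ((StdForm.antidiagonal N).over E)) ↥(unitaryGroupOfForm (c : E →+* E) ((StdForm.antidiagonal N).over E))),
        φ ((quasiSplit F E c N).toAdelic (Quotient.out q : ↥(unitaryGroupOfForm (c : E →+* E) ((StdForm.antidiagonal N).over E))) * g) * ((borelHeight ((quasiSplit F E c N).toAdelic (Quotient.out q : ↥(unitaryGroupOfForm (c : E →+* E) ((StdForm.antidiagonal N).over E))) * g) : ℝ) : ℂ) ^ z := rfl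

/-- Automorphy of the campaign's series: `E(f_z)(γ₀ g) = E(f_z)(g)` for `γ₀ ∈ G(F)`, `φ` left-`B(F)`-invariant (§1 `eisensteinSeriesU_rational_mul` at `f = f_z`). [cite: MoeglinWaldspurger1995, II.1.5] -/
theorem eisensteinSeriesU_flatSectionU_rational_mul {φ : (quasiSplit F E c N).Adelic → ℂ}
    (hφ : ∀ b ∈ borelU (c : E →+* E) ((StdForm.antidiagonal N).over E), ∀ x : (quasiSplit F E c N).Adelic, φ ((quasiSplit F E c N).toAdelic b * x) = φ x) (z : ℂ)
    (γ₀ : ↥(unitaryGroupOfForm (c : E →+* E) ((StdForm.antidiagonal N).over E))) (g : (quasiSplit F E c N).Adelic) :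
    eisensteinSeriesU (flatSectionU φ z) ((quasiSplit F E c N).toAdelic γ₀ * g) = eisensteinSeriesU (flatSectionU φ z) g :=
  eisensteinSeriesU_rational_mul (flatSectionU_toAdelic_mul hφ z) γ₀ g

end Mok

end Summit.HodgeConjecture.HodgeConjecture.Cruxes.H413.K2E1BorelEisensteinU

end
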